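import Summits.HodgeConjecture.HodgeConjecture.Theses.GenericDivisibility
import Summits.HodgeConjecture.HodgeConjecture.Theorems.GenericDivisibilityHodgeClassesGenericallyDivisibleFinite
import Summits.HodgeConjecture.HodgeConjecture.Theorems.GenericDivisibilityGenericDivisibilityBoundedLevelCleanFunnel
import Literature.AlgebraicGeometry.HodgeTheory.SupportedClassesOfChowZeroSupportedAboveDim
import Literature.AlgebraicGeometry.HodgeTheory.ZariskiOpenBettiFinitenessProofs
import Literature.AlgebraicGeometry.HodgeTheory.AndreottiFrankelTorsionFree
import Literature.AlgebraicTopology.SingularHomology.UniversalCoefficientsFree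
import HarnessLib

/-!
# Above the dimension every integral class is generically zero (crux C1, harvest `AboveDimGenericallyZero`)

Route `GenericDivisibility`, crux C1 `HodgeClassesGenericallyDivisible` (stmt-HodgeConjecture-18466).
Hodge-free support lemma named as provable harvest by the crux-triage panel (`TRIAGE-r2-1.md`,
"`AboveDimGenericallyZero` (AF + UCT + CT–V 3.1)") and by the strategist's census
(`STRATEGY-CENSUS.md` §6): the INTEGRAL, finite-level shadow of the affine Lefschetz theorem.

For `X` smooth projective over `ℂ` of dimension `n` and `U ⊆ X` an affine open:

* `genericDivisibility_isZero_singularHomology_complexPointsCompl_compl` — `H_j((X ∖ (X ∖ U))(ℂ); M) = 0`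
  for `j ≥ n + 1` (Andreotti–Frankel, Voisin II Thm. 1.22, PROVED in the tree as
  `AffineCoordinates.isZero_singularHomology_setOf_pt_mem_affineOpen`, transported to the carrier
  `complexPointsCompl X (U : Set X)ᶜ` of the route decls).
* `genericDivisibility_subsingleton_singularCohomology_complexPointsCompl_compl` — hence
  `H^k((X ∖ (X ∖ U))(ℂ); R) = 0` for `k ≥ n + 2` over any PID `R` (universal coefficients with
  `H_k = H_{k-1} = 0`, Hatcher Thm. 3.2: the tree's `kroneckerPairing_bijective_of_isZero`).
* `genericDivisibility_aboveDim_restrict_eq_zero` / `stub_aboveDimGenericallyZero` — **every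
  `w ∈ H^k(X(ℂ); ℤ)`, `k ≥ n + 2`, vanishes on the complex points of a non-empty Zariski open**
  (registered sub-goal of stmt-HodgeConjecture-18466; the card's `AboveDimGenericallyZero` for `k ≥ n + 2`).
* `genericDivisibility_aboveDim_exists_nsmul_restrict_eq_zero` — in the boundary degree
  `k = n + 1` the restriction of `w` to an affine open is TORSION (`H^{n+1} ≅ Ext(H_n, ℤ)` there:
  `H_{n+1} = 0`, `H_n` finitely generated by the tree's Dimca theorem
  `Dimca1992_finite_singularHomology_complexPointsCompl_holds`), i.e. `w` is generically torsion, and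
  `genericDivisibility_aboveDim_ringChange_mem_supportedClasses` — so `w ⊗ ℂ` has coniveau `≥ 1` in
  every degree `k ≥ n + 1`. Killing the torsion in degree `n + 1` integrally is exactly where
  Colliot-Thélène–Voisin Thm. 3.1 (`TorsionDiesGenerically`) would enter; it is not used here.

**Sharp form (appended).** With the torsion half of Andreotti–Frankel's theorem
(`AffineCoordinates.isAddTorsionFree_singularHomology_setOf_pt_mem_affineOpen`, Andreotti–Frankel 1959
Thm. 1: `H_n(U(ℂ); ℤ)` has no torsion) the boundary degree needs no torsion input after all:
`H_n(U(ℂ); ℤ)` is finitely generated (Dimca) and torsion-free, hence free, so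
`H^{n+1}(U(ℂ); ℤ) ≅ Hom(H_{n+1}, ℤ) ⊕ Ext(H_n, ℤ) = 0`
(`genericDivisibility_subsingleton_singularCohomology_complexPointsCompl_compl_succ`), and
**`AboveDimGenericallyZero` holds exactly as typed on the card, for every `k > n`, unconditionally**
(`genericDivisibility_aboveDim_restrict_eq_zero'`, registered sub-goal `stub_aboveDimGenericallyZero_sharp`).

References: [VoisinHodgeII2003] §1.2.2 Thm. 1.22; [AndreottiFrankel1959] Thm. 1; [HatcherAT2002]
§3.1 Thm. 3.2, Cor. 3.3; [Dimca1992] Ch. 1 Cor. (6.10); [ColliotTheleneVoisin2012] Thm. 3.1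
(context only). -/

set_option linter.dupNamespace false

noncomputable section

namespace Summit.HodgeConjecture.HodgeConjecture.Theorems

open CategoryTheory CategoryTheory.Limits AlgebraicGeometry
open Literature.AlgebraicGeometry.Motives Literature.AlgebraicGeometry.HodgeTheory
  Literature.AlgebraicTopology.SingularHomology
open Summit.HodgeConjecture.HodgeConjecture.Theses.GenericDivisibility


/-! ### Andreotti–Frankel on the carrier `complexPointsCompl X (X ∖ U)` -/

/-- **Andreotti–Frankel over an affine open, on the route's carrier.** For `X` smooth projective of
dimension `n` over `ℂ` and `U ⊆ X` an affine open, the complex points of `X` off the closed set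
`X ∖ U` — the space `complexPointsCompl X (U : Set X)ᶜ = U(ℂ)` — have `H_j = 0` for every
`j ≥ n + 1` and all coefficients (Voisin II Thm. 1.22, the tree's
`AffineCoordinates.isZero_singularHomology_setOf_pt_mem_affineOpen`, transported along
`{P | P.pt ∈ U} = {P | P.pt ∉ Uᶜ}`). [cite: VoisinHodgeII2003, §1.2.2 Thm. 1.22] -/
theorem genericDivisibility_isZero_singularHomology_complexPointsCompl_compl {n : ℕ}
    {X : SchemeOver ℂ} (hX : IsSmoothProjective n X) {U : X.left.Opens} (hU : IsAffineOpen U)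
    (R M₀ : Type) [CommRing R] [AddCommGroup M₀] [Module R M₀] {j : ℕ} (hj : n + 1 ≤ j) :
    IsZero (singularHomology R M₀ (complexPointsCompl X ((U : Set X.left)ᶜ)) j) := by
  haveI := hX.smoothOfRelativeDimension
  haveI : LocallyOfFiniteType X.hom := locallyOfFiniteType_of_isSmoothProjective hX
  have h0 : IsZero (singularHomology R M₀ ↥{P : ComplexPoints X | P.pt ∈ (U : Set X.left)} j) :=
    AffineCoordinates.isZero_singularHomology_setOf_pt_mem_affineOpen X _ hU hj
  have hset : {P : ComplexPoints X | P.pt ∈ (U : Set X.left)} =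
      {P : ComplexPoints X | P.pt ∉ (U : Set X.left)ᶜ} := by
    ext P
    simp
  let e : ↥{P : ComplexPoints X | P.pt ∈ (U : Set X.left)} ≃ₜ
      complexPointsCompl X ((U : Set X.left)ᶜ) :=
    Homeomorph.setCongr hset
  exact h0.of_iso ((HomologicalComplex.homologyFunctor _ _ j).mapIso
    (singularChainComplex.mapHomeomorph R M₀ e)).symm

/-! ### Universal coefficients: `H^k(U(ℂ); R) = 0` for `k ≥ n + 2` -/

/-- **`H^k(U(ℂ); R) = 0` for an affine open `U` of a smooth projective `n`-fold and `k ≥ n + 2`**,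
over any PID `R`: `H_{k-1} = H_k = 0` (Andreotti–Frankel), so the Kronecker map
`H^k → Hom(H_k, R) = 0` is bijective (Hatcher Thm. 3.2 with vanishing `Ext(H_{k-1}, R)`; the
tree's `kroneckerPairing_bijective_of_isZero`). [cite: HatcherAT2002, §3.1 Thm. 3.2] -/
theorem genericDivisibility_subsingleton_singularCohomology_complexPointsCompl_compl {n : ℕ}
    {X : SchemeOver ℂ} (hX : IsSmoothProjective n X) {U : X.left.Opens} (hU : IsAffineOpen U)
    (R : Type) [CommRing R] [IsDomain R] [IsPrincipalIdealRing R] {k : ℕ} (hk : n + 2 ≤ k) :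
    Subsingleton (singularCohomology R R (complexPointsCompl X ((U : Set X.left)ᶜ)) k) := by
  obtain ⟨j, rfl⟩ : ∃ j, k = j + 1 := ⟨k - 1, by omega⟩
  have hj : IsZero (singularHomology R R (complexPointsCompl X ((U : Set X.left)ᶜ)) j) :=
    genericDivisibility_isZero_singularHomology_complexPointsCompl_compl hX hU R R (by omega)
  have hj1 : IsZero (singularHomology R R (complexPointsCompl X ((U : Set X.left)ᶜ)) (j + 1)) :=
    genericDivisibility_isZero_singularHomology_complexPointsCompl_compl hX hU R R (by omega)
  haveI := ModuleCat.subsingleton_of_isZero hj1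
  haveI : Subsingleton
      (singularHomology R R (complexPointsCompl X ((U : Set X.left)ᶜ)) (j + 1) →ₗ[R] R) :=
    ⟨fun f g ↦ LinearMap.ext fun x ↦ by rw [Subsingleton.elim x 0, map_zero, map_zero]⟩
  exact (kroneckerPairing_bijective_of_isZero R _ j hj).1.subsingleton

/-- Restriction to the complex points over an affine open kills every class of degree
`k ≥ n + 2` (`H^k(U(ℂ); ℤ) = 0`). [cite: VoisinHodgeII2003, §1.2.2 Thm. 1.22]
[cite: HatcherAT2002, §3.1 Thm. 3.2] -/
theorem genericDivisibility_restrict_compl_affineOpen_eq_zero {n : ℕ} {X : SchemeOver ℂ}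
    (hX : IsSmoothProjective n X) {U : X.left.Opens} (hU : IsAffineOpen U) {k : ℕ} (hk : n + 2 ≤ k)
    (w : singularCohomology ℤ ℤ (ComplexPoints X) k) :
    singularCohomology.map ℤ ℤ
      (⟨Subtype.val, continuous_subtype_val⟩ :
        C(complexPointsCompl X ((U : Set X.left)ᶜ), ComplexPoints X)) k w = 0 := by
  haveI := genericDivisibility_subsingleton_singularCohomology_complexPointsCompl_compl hX hU ℤ hk
  exact Subsingleton.elim _ _

/-! ### A non-empty affine open, and its proper closed complement -/

/-- A smooth projective complex variety has an affine open `U` whose closed complement `X ∖ U` is a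
PROPER subset (any affine neighbourhood of a point of the non-empty integral scheme `X`).
[folklore] -/
theorem genericDivisibility_exists_isAffineOpen_compl_ne_univ {n : ℕ} {X : SchemeOver ℂ}
    (hX : IsSmoothProjective n X) :
    ∃ U : X.left.Opens, IsAffineOpen U ∧ IsClosed ((U : Set X.left)ᶜ) ∧
      (U : Set X.left)ᶜ ≠ Set.univ := by
  haveI : IsIntegral X.left := IsSmoothProjective.isIntegral_holds hX
  obtain ⟨U, hU, hxU, -⟩ := exists_isAffineOpen_mem_and_subset (X := X.left)
    (x := genericPoint X.left) (U := ⊤) trivial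
  refine ⟨U, hU, U.isOpen.isClosed_compl, fun h ↦ ?_⟩
  have hx : genericPoint X.left ∈ (U : Set X.left)ᶜ := h ▸ Set.mem_univ _
  exact hx hxU

/-! ### `AboveDimGenericallyZero`: degrees `k ≥ n + 2` -/

/-- **Above the dimension (by two) every integral class is generically ZERO.** For `X` smooth
projective over `ℂ` of dimension `n`, `k ≥ n + 2` and `w ∈ H^k(X(ℂ); ℤ)`, there is a Zariski-closed
`Z ⊊ X` with `w|_{(X∖Z)(ℂ)} = 0` — the complement of any non-empty affine open (Andreotti–Frankel
and universal coefficients). Hodge-free. [cite: VoisinHodgeII2003, §1.2.2 Thm. 1.22]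
[cite: HatcherAT2002, §3.1 Thm. 3.2] -/
theorem genericDivisibility_aboveDim_restrict_eq_zero {n : ℕ} {X : SchemeOver ℂ}
    (hX : IsSmoothProjective n X) {k : ℕ} (hk : n + 2 ≤ k)
    (w : singularCohomology ℤ ℤ (ComplexPoints X) k) :
    ∃ Z : Set X.left, IsClosed Z ∧ Z ≠ Set.univ ∧
      singularCohomology.map ℤ ℤ
        (⟨Subtype.val, continuous_subtype_val⟩ : C(complexPointsCompl X Z, ComplexPoints X)) k w = 0 := by
  obtain ⟨U, hU, hUc, hUne⟩ := genericDivisibility_exists_isAffineOpen_compl_ne_univ hX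
  exact ⟨(U : Set X.left)ᶜ, hUc, hUne, genericDivisibility_restrict_compl_affineOpen_eq_zero hX hU hk w⟩

/-- **Registered sub-goal `stub_aboveDimGenericallyZero` of stmt-HodgeConjecture-18466** — the harvest
item `AboveDimGenericallyZero` of the crux-triage panel (TRIAGE-r2-1) and of the strategist's census
(§6) in the degrees where it holds integrally without any input on torsion: for every smooth
projective complex `n`-fold `X`, every `k ≥ n + 2` and every `w ∈ H^k(X(ℂ); ℤ)` there is a closed
`Z ≠ X` with `w|_{(X∖Z)(ℂ)} = 0`. [cite: VoisinHodgeII2003, §1.2.2 Thm. 1.22]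
[cite: HatcherAT2002, §3.1 Thm. 3.2] -/
theorem stub_aboveDimGenericallyZero :
    ∀ ⦃n k : ℕ⦄ ⦃X : SchemeOver ℂ⦄, IsSmoothProjective n X → n + 2 ≤ k →
      ∀ w : singularCohomology ℤ ℤ (ComplexPoints X) k,
        ∃ Z : Set X.left, IsClosed Z ∧ Z ≠ Set.univ ∧
          singularCohomology.map ℤ ℤ
            (⟨Subtype.val, continuous_subtype_val⟩ : C(complexPointsCompl X Z, ComplexPoints X)) k w = 0 :=
  fun _ _ _ hX hk w ↦ genericDivisibility_aboveDim_restrict_eq_zero hX hk w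

/-! ### The boundary degree `k = n + 1`: generically torsion -/

/-- **In degree `n + 1` the restriction to an affine open is TORSION.** For `X` smooth projective of
dimension `n`, `U ⊆ X` an affine open and `w ∈ H^{n+1}(X(ℂ); ℤ)`: the complexification of
`w|_{U(ℂ)}` vanishes (`H^{n+1}(U(ℂ); ℂ) = 0`, the tree's `restrictCompl_compl_eq_zero_of_isAffineOpen`),
and an integral class with vanishing complexification is torsion when `H_n(U(ℂ); ℤ)` is finitely
generated (Hatcher Thm. 3.2 / p. 196, the tree's `ker_kroneckerPairing_le_torsion` through
`genericDivisibility_exists_nsmul_eq_zero_of_ringChange_eq_zero`; finite generation is the tree's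
Dimca theorem `Dimca1992_finite_singularHomology_complexPointsCompl_holds`). In other words
`H^{n+1}(U(ℂ); ℤ) ≅ Ext(H_n(U(ℂ); ℤ), ℤ)` is a finite group. [cite: HatcherAT2002, §3.1 Thm. 3.2 and p. 196]
[cite: Dimca1992, Ch. 1 Cor. (6.10)] [cite: VoisinHodgeII2003, §1.2.2 Thm. 1.22] -/
theorem genericDivisibility_exists_nsmul_restrict_compl_affineOpen_eq_zero {n : ℕ} {X : SchemeOver ℂ}
    (hX : IsSmoothProjective n X) {U : X.left.Opens} (hU : IsAffineOpen U)
    (w : singularCohomology ℤ ℤ (ComplexPoints X) (n + 1)) :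
    ∃ N : ℕ, 1 ≤ N ∧ N • singularCohomology.map ℤ ℤ
      (⟨Subtype.val, continuous_subtype_val⟩ :
        C(complexPointsCompl X ((U : Set X.left)ᶜ), ComplexPoints X)) (n + 1) w = 0 := by
  haveI : Module.Finite ℤ (singularHomology ℤ ℤ (complexPointsCompl X ((U : Set X.left)ᶜ)) n) :=
    Dimca1992_finite_singularHomology_complexPointsCompl_holds hX _ U.isOpen.isClosed_compl n
  refine genericDivisibility_exists_nsmul_eq_zero_of_ringChange_eq_zero (k := n) rfl _ ?_
  rw [genericDivisibility_ringChange_map]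
  exact restrictCompl_compl_eq_zero_of_isAffineOpen hX hU le_rfl _

/-- **In degree `n + 1` every integral class is generically TORSION**: for `X` smooth projective of
dimension `n` and `w ∈ H^{n+1}(X(ℂ); ℤ)` there are a closed `Z ⊊ X` and `N ≥ 1` with
`N • w|_{(X∖Z)(ℂ)} = 0` (the `GT` of the C2 files). This is the honest integral content of the
harvest item `AboveDimGenericallyZero` at `k = n + 1`; upgrading "torsion" to "zero" on a smaller open
is precisely an instance of Colliot-Thélène–Voisin's Thm. 3.1 (Bloch–Kato), not used here.
[cite: HatcherAT2002, §3.1 Thm. 3.2 and p. 196] [cite: Dimca1992, Ch. 1 Cor. (6.10)] -/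
theorem genericDivisibility_aboveDim_exists_nsmul_restrict_eq_zero {n : ℕ} {X : SchemeOver ℂ}
    (hX : IsSmoothProjective n X) (w : singularCohomology ℤ ℤ (ComplexPoints X) (n + 1)) :
    ∃ Z : Set X.left, IsClosed Z ∧ Z ≠ Set.univ ∧ ∃ N : ℕ, 1 ≤ N ∧
      N • singularCohomology.map ℤ ℤ
        (⟨Subtype.val, continuous_subtype_val⟩ : C(complexPointsCompl X Z, ComplexPoints X))
        (n + 1) w = 0 := by
  obtain ⟨U, hU, hUc, hUne⟩ := genericDivisibility_exists_isAffineOpen_compl_ne_univ hX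
  exact ⟨(U : Set X.left)ᶜ, hUc, hUne,
    genericDivisibility_exists_nsmul_restrict_compl_affineOpen_eq_zero hX hU w⟩

/-- **Above the dimension every integral class has complexification of coniveau `≥ 1`**: for `X`
smooth projective of dimension `n`, `k ≥ n + 1` and `w ∈ H^k(X(ℂ); ℤ)`,
`w ⊗ ℂ ∈ supportedClasses X k 1` (generically torsion in degree `n + 1`, generically zero above, and
the bridge `GT ⊗ ℂ ⊆ N¹` of the C2 files, `genericDivisibilityBounded_ringChange_mem_supportedClasses`).
For complex classes this is the tree's `restrictCompl_compl_eq_zero_of_isAffineOpen`; recorded here in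
the integral vocabulary of the route. [cite: VoisinHodgeII2003, §1.2.2 Thm. 1.22 and §11.3] -/
theorem genericDivisibility_aboveDim_ringChange_mem_supportedClasses {n : ℕ} {X : SchemeOver ℂ}
    (hX : IsSmoothProjective n X) {k : ℕ} (hk : n + 1 ≤ k)
    (w : singularCohomology ℤ ℤ (ComplexPoints X) k) :
    singularCohomology.ringChange (Int.castRingHom ℂ) (ComplexPoints X) k w ∈ supportedClasses X k 1 := by
  refine genericDivisibilityBounded_ringChange_mem_supportedClasses hX ?_
  rcases Nat.eq_or_lt_of_le hk with h | h
  · subst h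
    exact genericDivisibility_aboveDim_exists_nsmul_restrict_eq_zero hX w
  · obtain ⟨Z, hZ, hZne, h0⟩ := genericDivisibility_aboveDim_restrict_eq_zero hX (by omega) w
    exact ⟨Z, hZ, hZne, 1, le_rfl, by rw [h0, smul_zero]⟩

/-! ### Sharp form: the boundary degree `k = n + 1` is generically ZERO too (Andreotti–Frankel, torsion half) -/

/-- **`H_n` of the complex points over an affine open of a smooth projective `n`-fold has no
torsion**, on the route's carrier `complexPointsCompl X (X ∖ U)` (Andreotti–Frankel 1959, Thm. 1,
the tree's `AffineCoordinates.isAddTorsionFree_singularHomology_setOf_pt_mem_affineOpen`, transported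
along `{P | P.pt ∈ U} = {P | P.pt ∉ Uᶜ}`). [cite: AndreottiFrankel1959, Thm. 1] -/
theorem genericDivisibility_isAddTorsionFree_singularHomology_complexPointsCompl_compl {n : ℕ}
    {X : SchemeOver ℂ} (hX : IsSmoothProjective n X) {U : X.left.Opens} (hU : IsAffineOpen U)
    {j : ℕ} (hj : n ≤ j) :
    IsAddTorsionFree (singularHomology ℤ ℤ (complexPointsCompl X ((U : Set X.left)ᶜ)) j) := by
  haveI := hX.smoothOfRelativeDimension
  haveI : LocallyOfFiniteType X.hom := locallyOfFiniteType_of_isSmoothProjective hX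
  haveI h0 := AffineCoordinates.isAddTorsionFree_singularHomology_setOf_pt_mem_affineOpen X U hU hj
  have hset : {P : ComplexPoints X | P.pt ∈ (U : Set X.left)} =
      {P : ComplexPoints X | P.pt ∉ (U : Set X.left)ᶜ} := by
    ext P
    simp
  let e : ↥{P : ComplexPoints X | P.pt ∈ (U : Set X.left)} ≃ₜ
      complexPointsCompl X ((U : Set X.left)ᶜ) :=
    Homeomorph.setCongr hset
  let ι : singularHomology ℤ ℤ ↥{P : ComplexPoints X | P.pt ∈ (U : Set X.left)} j ≅
      singularHomology ℤ ℤ (complexPointsCompl X ((U : Set X.left)ᶜ)) j :=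
    (HomologicalComplex.homologyFunctor _ _ j).mapIso (singularChainComplex.mapHomeomorph ℤ ℤ e)
  exact Function.Injective.isAddTorsionFree (ModuleCat.Hom.hom ι.inv).toAddMonoidHom
    ι.toLinearEquiv.symm.injective

/-- **`H^{n+1}(U(ℂ); ℤ) = 0` for an affine open `U` of a smooth projective `n`-fold** (on the carrier
`complexPointsCompl X (X ∖ U)`): `H_{n+1} = 0` (Andreotti–Frankel), and `H_n` is finitely generated
(Dimca, the tree's `Dimca1992_finite_singularHomology_complexPointsCompl_holds`) without torsion
(Andreotti–Frankel 1959 Thm. 1), hence free, so the Kronecker map `H^{n+1} → Hom(H_{n+1}, ℤ) = 0`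
is bijective (Hatcher Thm. 3.2; the tree's `kroneckerPairing_bijective_of_free`).
[cite: AndreottiFrankel1959, Thm. 1] [cite: HatcherAT2002, §3.1 Thm. 3.2] [cite: Dimca1992, Ch. 1 Cor. (6.10)] -/
theorem genericDivisibility_subsingleton_singularCohomology_complexPointsCompl_compl_succ {n : ℕ}
    {X : SchemeOver ℂ} (hX : IsSmoothProjective n X) {U : X.left.Opens} (hU : IsAffineOpen U) :
    Subsingleton (singularCohomology ℤ ℤ (complexPointsCompl X ((U : Set X.left)ᶜ)) (n + 1)) := by
  haveI : Module.Finite ℤ (singularHomology ℤ ℤ (complexPointsCompl X ((U : Set X.left)ᶜ)) n) :=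
    Dimca1992_finite_singularHomology_complexPointsCompl_holds hX _ U.isOpen.isClosed_compl n
  haveI := genericDivisibility_isAddTorsionFree_singularHomology_complexPointsCompl_compl hX hU
    (j := n) le_rfl
  -- torsion-free for the `ℤ`-module structure in use (all `ℤ`-module structures coincide)
  haveI : Module.IsTorsionFree ℤ (singularHomology ℤ ℤ (complexPointsCompl X ((U : Set X.left)ᶜ)) n) := by
    have h : @Module.IsTorsionFree ℤ
        (singularHomology ℤ ℤ (complexPointsCompl X ((U : Set X.left)ᶜ)) n) _ _
        (AddCommGroup.toIntModule _) := inferInstance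
    first
      | exact h
      | (convert h using 2; exact Subsingleton.elim _ _)
  haveI : Module.Free ℤ (singularHomology ℤ ℤ (complexPointsCompl X ((U : Set X.left)ᶜ)) n) :=
    inferInstance
  have h1 : IsZero (singularHomology ℤ ℤ (complexPointsCompl X ((U : Set X.left)ᶜ)) (n + 1)) :=
    genericDivisibility_isZero_singularHomology_complexPointsCompl_compl hX hU ℤ ℤ le_rfl
  haveI := ModuleCat.subsingleton_of_isZero h1
  haveI : Subsingleton
      (singularHomology ℤ ℤ (complexPointsCompl X ((U : Set X.left)ᶜ)) (n + 1) →ₗ[ℤ] ℤ) :=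
    ⟨fun f g ↦ LinearMap.ext fun x ↦ by rw [Subsingleton.elim x 0, map_zero, map_zero]⟩
  exact (kroneckerPairing_bijective_of_free ℤ _ n).1.subsingleton

/-- **`H^k(U(ℂ); ℤ) = 0` for every `k > n`** (affine open `U` of a smooth projective `n`-fold, on the
carrier `complexPointsCompl X (X ∖ U)`): the sharp Andreotti–Frankel theorem in cohomology.
[cite: AndreottiFrankel1959, Thm. 1] [cite: HatcherAT2002, §3.1 Thm. 3.2] -/
theorem genericDivisibility_subsingleton_singularCohomology_complexPointsCompl_compl' {n : ℕ}
    {X : SchemeOver ℂ} (hX : IsSmoothProjective n X) {U : X.left.Opens} (hU : IsAffineOpen U)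
    {k : ℕ} (hk : n < k) :
    Subsingleton (singularCohomology ℤ ℤ (complexPointsCompl X ((U : Set X.left)ᶜ)) k) := by
  rcases Nat.lt_or_ge (n + 1) k with h | h
  · exact genericDivisibility_subsingleton_singularCohomology_complexPointsCompl_compl hX hU ℤ h
  · obtain rfl : k = n + 1 := by omega
    exact genericDivisibility_subsingleton_singularCohomology_complexPointsCompl_compl_succ hX hU

/-- Restriction to the complex points over an affine open kills every integral class of degree
`k > n` (sharp form of `genericDivisibility_restrict_compl_affineOpen_eq_zero`).
[cite: AndreottiFrankel1959, Thm. 1] [cite: HatcherAT2002, §3.1 Thm. 3.2] -/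
theorem genericDivisibility_restrict_compl_affineOpen_eq_zero' {n : ℕ} {X : SchemeOver ℂ}
    (hX : IsSmoothProjective n X) {U : X.left.Opens} (hU : IsAffineOpen U) {k : ℕ} (hk : n < k)
    (w : singularCohomology ℤ ℤ (ComplexPoints X) k) :
    singularCohomology.map ℤ ℤ
      (⟨Subtype.val, continuous_subtype_val⟩ :
        C(complexPointsCompl X ((U : Set X.left)ᶜ), ComplexPoints X)) k w = 0 := by
  haveI := genericDivisibility_subsingleton_singularCohomology_complexPointsCompl_compl' hX hU hk
  exact Subsingleton.elim _ _

/-- **`AboveDimGenericallyZero`, sharp and unconditional: above the dimension every integral class is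
generically ZERO.** For `X` smooth projective over `ℂ` of dimension `n`, EVERY `k > n` and
`w ∈ H^k(X(ℂ); ℤ)` there is a Zariski-closed `Z ⊊ X` (the complement of any non-empty affine open)
with `w|_{(X∖Z)(ℂ)} = 0` — Andreotti–Frankel with its torsion half, universal coefficients and Dimca's
finiteness; no Bloch–Kato / Colliot-Thélène–Voisin input. Hodge-free.
[cite: AndreottiFrankel1959, Thm. 1] [cite: VoisinHodgeII2003, §1.2.2 Thm. 1.22]
[cite: HatcherAT2002, §3.1 Thm. 3.2] [cite: Dimca1992, Ch. 1 Cor. (6.10)] -/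
theorem genericDivisibility_aboveDim_restrict_eq_zero' {n : ℕ} {X : SchemeOver ℂ}
    (hX : IsSmoothProjective n X) {k : ℕ} (hk : n < k)
    (w : singularCohomology ℤ ℤ (ComplexPoints X) k) :
    ∃ Z : Set X.left, IsClosed Z ∧ Z ≠ Set.univ ∧
      singularCohomology.map ℤ ℤ
        (⟨Subtype.val, continuous_subtype_val⟩ : C(complexPointsCompl X Z, ComplexPoints X)) k w = 0 := by
  obtain ⟨U, hU, hUc, hUne⟩ := genericDivisibility_exists_isAffineOpen_compl_ne_univ hX
  exact ⟨(U : Set X.left)ᶜ, hUc, hUne, genericDivisibility_restrict_compl_affineOpen_eq_zero' hX hU hk w⟩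

/-- **Registered sub-goal `stub_aboveDimGenericallyZero_sharp` of stmt-HodgeConjecture-18466** — the
harvest item `AboveDimGenericallyZero` EXACTLY as typed on the card
`Ideas/abel-jacobi-torsion-descent.md` (`n < k`), now a theorem with no torsion caveat: for every
smooth projective complex `n`-fold `X`, every `k > n` and every `w ∈ H^k(X(ℂ); ℤ)` there is a closed
`Z ≠ X` with `w|_{(X∖Z)(ℂ)} = 0`. [cite: AndreottiFrankel1959, Thm. 1]
[cite: VoisinHodgeII2003, §1.2.2 Thm. 1.22] [cite: HatcherAT2002, §3.1 Thm. 3.2] -/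
theorem stub_aboveDimGenericallyZero_sharp :
    ∀ ⦃n k : ℕ⦄ ⦃X : SchemeOver ℂ⦄, IsSmoothProjective n X → n < k →
      ∀ w : singularCohomology ℤ ℤ (ComplexPoints X) k,
        ∃ Z : Set X.left, IsClosed Z ∧ Z ≠ Set.univ ∧
          singularCohomology.map ℤ ℤ
            (⟨Subtype.val, continuous_subtype_val⟩ : C(complexPointsCompl X Z, ComplexPoints X)) k w = 0 :=
  fun _ _ _ hX hk w ↦ genericDivisibility_aboveDim_restrict_eq_zero' hX hk w

end Summit.HodgeConjecture.HodgeConjecture.Theorems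

end
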